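import Summits.KontsevichZagierPeriods.KontsevichZagierPeriods.Theorems.SymplecticScissorsRealOnePeriodRelationsStubArcSymbolsPieces
import Summits.KontsevichZagierPeriods.KontsevichZagierPeriods.Theorems.SymplecticScissorsRealOnePeriodRelationsStubPuiseuxGerm

/-!
# `RealOnePeriodRelations` (stmt-KontsevichZagierPeriods-10042), line `nash-retraction-thin-strip`:
# stub `stub_arcSymbols` — ARCS ARE SYMBOLS

The registered stub `stub_arcSymbols` of the lead skeleton
`Cruxes/RealOnePeriodRelations/Lines/nash-retraction-thin-strip.lean`: a 1-dimensional
Kontsevich–Zagier representation on the unit interval (with `C^∞` integrand) is, modulo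
`M₁ = closure (1a ∪ 1b ∪ 2 ∪ Green)`, a finite algebraic combination of REAL REALISATIONS of period
symbols of curve type (Huber–Wüstholz 2022, §3.3.1) along `ℚ`-semialgebraic `C¹` paths, with the same
value. Everything is assembled in the auxiliary files: cut at the algebraic break points of the
integrand and at mid-points (1a, `…StubArcSymbolsCut`), flatten every half-cell at its bad end by
`x = p ± C s^q` using the normalised Puiseux germ of one-sided semialgebraic germs
(`PuiseuxGerm.puiseuxGerm`, rule 2, `…StubArcSymbolsFlatten`), make the end point étale by the Taylor
shift and realise each standard piece on the standard-étale model (`…StubArcSymbolsAux2`, using the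
sibling crux's `CurvePeriodsTransfer.stub_etaleShift` / `stub_sectionSymbol`), and add up with
multiplicities (1b, `…StubArcSymbolsAux`). This file is the one-line conclusion
(`ArcSymbols.arcSymbols_of_germ` applied to the germ theorem); the smoothness hypothesis is not needed.

References: A. Huber, G. Wüstholz, *Transcendence and Linear Relations of 1-Periods* (2022),
Prop. 12.5, Cor. 12.7, §3.3.1; M. Kontsevich, D. Zagier, *Periods* (2001), §1.2.
-/

noncomputable section

open scoped BigOperators Topology
open Set MeasureTheory
open Literature.NumberTheory.Transcendental Literature.NumberTheory.Transcendental.CurvePeriods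
open Summit.KontsevichZagierPeriods.SymplecticScissors.RealOnePeriodRelationsNegative (M₁)

namespace Summit.KontsevichZagierPeriods.SymplecticScissors.RealOnePeriodRelations

/-- STUB `stub_arcSymbols` (XL core of `stub_normalisation`). ARCS ARE SYMBOLS: a representation on
`(0,1)` with `C^∞` (semialgebraic, integrable) integrand is, modulo `M₁`, a finite algebraic
combination of real realisations of period symbols of curve type along `ℚ`-semialgebraic `C¹` paths,
with the same value (piece reduction by rules 1a and 2 with Puiseux flattening of the bad ends, étale
Taylor shift, section symbols on standard-étale models, multiplicities by rule 1b).
[cite: HuberWustholz2022, Prop. 12.5 and Cor. 12.7] -/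
theorem stub_arcSymbols : ∀ ρ : KZ.IntegralRep 1, ρ.domain = {z | z 0 ∈ Set.Ioo (0 : ℝ) 1} →
    ContDiffOn ℝ ((⊤ : ℕ∞) : WithTop ℕ∞) (fun t : ℝ => ρ.integrand (fun _ : Fin 1 => t)) (Set.Ioo (0 : ℝ) 1) →
    ∃ (C : PeriodSymbol →₀ ℂ) (R : PeriodSymbol → KZ.IntegralRep 1), (∀ s, IsAlgebraic ℚ (C s)) ∧
      (∀ s ∈ C.support, IsSemialgebraicMapOn ℚ {z : Fin 1 → ℝ | z 0 ∈ Set.Icc (0 : ℝ) 1}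
        (fun z => Fin.append (fun i => (s.γ.toFun (z 0) i).re) (fun i => (s.γ.toFun (z 0) i).im))) ∧
      (∀ s ∈ C.support, (R s).domain = {z | z 0 ∈ Set.Ioo (0 : ℝ) 1} ∧ ∀ z ∈ (R s).domain, (R s).integrand z =
        (C s * ∑ i, MvPolynomial.eval (s.γ.toFun (z 0)) (s.ω i) * deriv (fun u => s.γ.toFun u i) (z 0)).re) ∧
      evalCombination C = ((ρ.value : ℝ) : ℂ) ∧ KZ.of ρ - ∑ s ∈ C.support, KZ.of (R s) ∈ M₁ :=
  fun ρ hdom _ => ArcSymbols.arcSymbols_of_germ PuiseuxGerm.puiseuxGerm ρ hdom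

end Summit.KontsevichZagierPeriods.SymplecticScissors.RealOnePeriodRelations

end
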